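import Literature.Computability.Cryptography.ZhandryOracleSimulator
import Literature.Computability.Cryptography.OracleAdversaryDecider
import Literature.Computability.Cryptography.OracleAdversaryFPRel
import HarnessLib

/-!
# Aaronson–Chen 2017, Thm. 7.6: "let `M` be a `BPP` machine" — the `BPP^O` machine as an oracle adversary (proof)

Second sibling proof file of `ZhandryOracle.lean` (D-0014; the first, `ZhandryOracleProofs.lean`,
discharges the leaf `aaronsonChen2017_thm76_memPPoly`): the named fact
`Literature.Computability.Cryptography.aaronsonChen2017_thm76_bppMachine` is PROVED here
(`aaronsonChen2017_thm76_bppMachine_holds`; the toolkit files `OracleCompositionUniform.lean` and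
`ZhandryOracleSimulator.lean` refer to this file under the working name `ZhandryOracleProofs.lean`). The fact is the folklore step of the proof of
Thm. 7.6 (S. Aaronson, L. Chen, CCC 2017, arXiv:1612.05903, p. 30: "So let `M` be a `BPP`
machine …"): a `BPP^O` machine `M`, run at the probe `1ⁿ` with coins `r` against the oracle
`specLang E T n j f` (cut off at its query bound `q |z|`, `z = ⟨1ⁿ, r⟩`), is simulated — with the
same acceptance probability — by ONE probabilistic polynomial-time oracle adversary
(`OracleAdversary`, the adversaries of the tree's `IsPRP`/`IsPRF`) given `1ⁿ` and oracle access to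
`f` on `{0,1}ʲ`, uniformly in `n ∉ E`, `1 ≤ j ≤ B n` and the length-preserving `f`.

The adversary (Arora–Barak 2009, §3.4 with Def. 7.3; Ladner–Lynch–Selman 1975, §2–3):

* `M₁ = M.clock q false` (`OracleQueryMap.lean`): `M` clocked at `q |z|` rounds, so that it
  outputs against every oracle, `true` exactly when `M` accepts within the clock
  (`OracleAlg.run_clock_eq_some_iff`);
* `M₂ = M₁.mapQuery d`, `d ⟨z, ⟨as, s⟩⟩ = ⟨z, s⟩`: every query `s` is tagged with the input `z`
  (`OracleAlg.run_mapQuery`), so that the intermediate oracle `midOracle q E T n j f`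
  (`⟨z, s⟩ ↦ [s ∈ specLang E T n j f ∧ |s| ≤ q |z|]`) answers it as the cut-off oracle answers `s`;
* the composite `C` of `M₂` with the polynomial-time non-adaptive simulator `simN q B E T` of
  `ZhandryOracleSimulator.lean`, which computes `midOracle q E T n j f` from `oracleOfFnAt j f`
  (`run_simN`) — composition uniformly in the oracles
  (`OracleAlg.exists_polyTime_compose_uniform`, `OracleCompositionUniform.lean`);
* coins `p`, rounds `qC (2n + 2 + p n)`; the acceptance probability is the uniform measure of the
  accepting coin strings (`OracleAdversary.acceptProb_eq_uniformProb`), which are those on which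
  `M` accepts (`StockMachine.uniformProb_congr` on the strings of length `p n`).

## References

* S. Aaronson, L. Chen, *Complexity-theoretic foundations of quantum supremacy experiments*,
  CCC 2017 (arXiv:1612.05903), Thm. 7.6 and its proof (p. 30) [AaronsonChen2017].
* S. Arora, B. Barak, *Computational Complexity: A Modern Approach*, CUP 2009, §3.4 (oracle
  machines), Def. 7.1/7.3 (probabilistic machines as deterministic machines reading a random
  string) [AroraBarak2009].
* R. E. Ladner, N. A. Lynch, A. L. Selman, Theoret. Comput. Sci. 1 (1975), §2–3
  [LadnerLynchSelman1975].
-/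

namespace Literature.Computability.Cryptography

open _root_.Computability Complexity Complexity.OracleCompose Complexity.PRelSigma Polynomial ZhandrySim

/-! ### Acceptance probability as a uniform probability -/

/-- **The acceptance probability of an oracle adversary on `1ⁿ` is the uniform probability, over
the coin strings of length `coins n`, of the deterministic run accepting.**
[Arora–Barak 2009, Def. 7.1 with §3.4; Goldreich 2001, Def. 3.6.4] [cite: AroraBarak2009, Def. 7.1 with §3.4] -/
theorem OracleAdversary.acceptProb_eq_uniformProb (𝒜 : OracleAdversary Bool) (O : Oracle) (n : ℕ) :
    𝒜.acceptProb O n = uniformProb (𝒜.coins.eval n)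
      {r : List Bool | 𝒜.alg.run O (𝒜.fuel.eval n) (boolPair (unaryEncodeNat n) r) = some true} := by
  unfold OracleAdversary.acceptProb
  rw [𝒜.toReal_outputPMF_some_true, uniformProb_eq_toOuterMeasure]
  have hn : (unaryEncodeNat n).length = n := by
    rw [Complexity.unaryEncodeNat_eq_replicate, List.length_replicate]
  rw [hn]
  rfl

/-! ### The queries of the tagged, clocked machine -/

/-- The tagging map `⟨z, ⟨as, s⟩⟩ ↦ ⟨z, s⟩` of the queries. [folklore] -/
theorem tagMap_apply (z v s : List Bool) :
    pairFn fstP (sndP ∘ sndP) (boolPair z (boolPair v s)) = boolPair z s := by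
  rw [pairFn_apply, fstP_boolPair, Function.comp_apply, sndP_boolPair, sndP_boolPair]

/-! ### The theorem -/

/-- **Aaronson–Chen 2017, proof of Thm. 7.6: "let `M` be a `BPP` machine" — PROVED.** A
`BPP^O` machine at the probe `1ⁿ`, against the oracle of shape `specLang E T n j f` cut off at
its query bound, is a probabilistic polynomial-time oracle adversary against `f` with the same
acceptance probability, uniformly in `n ∉ E`, `1 ≤ j ≤ B n` and the length-preserving `f`.
[cite: AaronsonChen2017, Thm. 7.6 (proof, p. 30)] [cite: AroraBarak2009, §3.4 and Def. 7.3] -/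
theorem aaronsonChen2017_thm76_bppMachine_holds : aaronsonChen2017_thm76_bppMachine := by
  intro M hM q p B E T
  -- the machines
  have hM₁ : (M.clock q false).IsPolyTime encodingBoolBool := OracleAlg.isPolyTime_clock _ hM q false
  have hd : pairFn fstP (sndP ∘ sndP) ∈ FP :=
    pairFn_mem_FP fstP_mem_FP (comp_mem_FP sndP_mem_FP sndP_mem_FP)
  have hM₂ : ((M.clock q false).mapQuery (pairFn fstP (sndP ∘ sndP))).IsPolyTime encodingBoolBool :=
    OracleAlg.isPolyTime_mapQuery _ hM₁ hd
  obtain ⟨R₁, hR₁⟩ := hM₁.exists_length_le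
  -- resource polynomials of the tagged machine and of the simulator
  obtain ⟨C, hC, qC, hCrun⟩ := OracleAlg.exists_polyTime_compose_uniform hM₂ (isPolyTime_simN q B E T)
    (q + 1 + (2 * X + 2 + R₁.comp (2 * X + 6 * (q + 1) + 4))) (X + B + 1)
  refine ⟨⟨C, p, qC.comp (2 * X + 2 + p)⟩, hC, fun n j f _ hj hjB hf => ?_⟩
  set M₂ := (M.clock q false).mapQuery (pairFn fstP (sndP ∘ sndP)) with hM₂def
  set qM : Polynomial ℕ := q + 1 + (2 * X + 2 + R₁.comp (2 * X + 6 * (q + 1) + 4)) with hqMdef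
  -- the key equivalence, for every coin string `r`
  have key : ∀ r : List Bool,
      C.run (oracleOfFnAt j f) (qC.eval (boolPair (unaryEncodeNat n) r).length) (boolPair (unaryEncodeNat n) r) =
          some true ↔
        M.run (Oracle.ofLanguage {s : List Bool | s ∈ specLang E T n j f ∧
            s.length ≤ q.eval (boolPair (unaryEncodeNat n) r).length})
          (q.eval (boolPair (unaryEncodeNat n) r).length) (boolPair (unaryEncodeNat n) r) = some true := by
    intro r
    set z := boolPair (unaryEncodeNat n) r with hz
    set O₀ : Oracle := Oracle.ofLanguage {s : List Bool | s ∈ specLang E T n j f ∧ s.length ≤ q.eval z.length}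
      with hO₀
    set fmid : Oracle := midOracle q E T n j f with hfmid
    -- the tagged machine with the intermediate oracle runs as the clocked machine with `O₀`
    have hagree : OracleAlg.MapAgree (M.clock q false) (pairFn fstP (sndP ∘ sndP)) fmid O₀ z := by
      intro i s _ _
      rw [tagMap_apply, hfmid, midOracle_boolPair, hO₀, ofLanguage_eq_singleton]
    have hrun2 : ∀ k, M₂.run fmid k z = (M.clock q false).run O₀ k z := fun k =>
      OracleAlg.run_mapQuery _ _ fmid O₀ z hagree k
    -- the clocked machine outputs within `q |z| + 1` rounds
    obtain ⟨b, hb⟩ := Option.isSome_iff_exists.1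
      (M.run_clock_isSome q false O₀ z (n := q.eval z.length + 1) (Nat.lt_succ_self _))
    have hbiff : b = true ↔ M.run O₀ (q.eval z.length) z = some true := by
      have h := OracleAlg.run_clock_eq_some_iff M q (b₀ := false) (b := true) (by simp) O₀ z
        (n := q.eval z.length + 1) (Nat.lt_succ_self _)
      rw [hb] at h
      simpa using h
    -- the run of `M₂` needed by the composition
    have hK₀ : q.eval z.length + 1 ≤ qM.eval z.length := by
      simp only [hqMdef, eval_add, eval_one]; omega
    have hMrun : M₂.run fmid (qM.eval z.length) z = some b := by
      rw [hrun2]; exact OracleAlg.run_mono _ O₀ z hK₀ hb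
    -- the queries of `M₂`: tagged, short queries of the clocked machine
    have hqry : ∀ u ∈ M₂.queries fmid (qM.eval z.length) z,
        ∃ s : List Bool, u = boolPair z s ∧ s.length < R₁.eval (2 * z.length + 6 * (q.eval z.length + 1) + 4) := by
      intro u hu
      rw [OracleAlg.queries_eq_of_run_eq_some M₂ fmid z hK₀ (by rw [hrun2]; exact hb)] at hu
      obtain ⟨i, hi, hall, rfl⟩ := exists_of_mem_queries M₂ fmid _ z u hu
      obtain ⟨y', hy'⟩ := hall i le_rfl
      rw [qryOf_eq_of_step_eq hy']
      rw [hM₂def, OracleAlg.mapQuery_step] at hy'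
      cases hs : (M.clock q false).step z (trans M₂ fmid z i) with
      | inr b' => rw [hs] at hy'; cases hy'
      | inl s =>
        rw [hs] at hy'
        simp only [Sum.inl.injEq] at hy'
        refine ⟨s, ?_, ?_⟩
        · rw [← hy', tagMap_apply]
        · have has : ∀ a ∈ trans M₂ fmid z i, a.length ≤ 1 :=
            OracleAlg.length_le_one_of_mem_trans_ofLanguage M₂ _ z i
          have h1 := OracleAlg.length_query_lt hR₁ hs has
          rw [length_trans] at h1
          exact h1.trans_le (TM2Iter.eval_mono R₁ (by omega))
    have hMq : ∀ u ∈ M₂.queries fmid (qM.eval z.length) z, u.length ≤ qM.eval z.length := by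
      intro u hu
      obtain ⟨s, rfl, hs⟩ := hqry u hu
      rw [length_boolPair]
      simp only [hqMdef, eval_add, eval_mul, eval_one, eval_ofNat, eval_X, eval_comp]
      omega
    -- the simulator computes the intermediate oracle on these queries
    have hN : ∀ u ∈ M₂.queries fmid (qM.eval z.length) z,
        (simN q B E T).run (oracleOfFnAt j f) ((X + B + 1).eval u.length) u = some (fmid u) ∧
          ∀ y ∈ (simN q B E T).queries (oracleOfFnAt j f) ((X + B + 1).eval u.length) u,
            y.length ≤ (X + B + 1).eval u.length := by
      intro u hu
      obtain ⟨s, rfl, -⟩ := hqry u hu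
      refine ⟨?_, fun y hy => ?_⟩
      · rw [hz, hfmid]
        exact run_simN q B E T hj hjB hf r s (by simp only [eval_add, eval_X, eval_one]; omega)
      · have := length_le_of_mem_queries_simN q B E T _ _ hy
        simp only [eval_add, eval_X, eval_one]
        omega
    -- the composite machine
    have hC := (hCrun (oracleOfFnAt j f) fmid z b hMrun hMq hN).1
    rw [hC, Option.some.injEq, hbiff]
  -- the acceptance probability
  rw [OracleAdversary.acceptProb_eq_uniformProb]
  refine StockMachine.uniformProb_congr fun r hr => ?_
  simp only [Set.mem_setOf_eq]
  have hlen : (boolPair (unaryEncodeNat n) r).length = 2 * n + 2 + p.eval n := by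
    rw [length_boolPair, hr, Complexity.unaryEncodeNat_eq_replicate, List.length_replicate]
  have h := key r
  rw [hlen] at h
  simp only [eval_comp, eval_add, eval_mul, eval_ofNat, eval_X]
  rw [hlen]
  exact h

end Literature.Computability.Cryptography
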